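import Literature.AlgebraicGeometry.AbelianSchemes.AbelianSchemeDualTransportNoetherian
import Literature.AlgebraicGeometry.AbelianSchemes.AbelianSchemeDualTransportUnique
import Literature.AlgebraicGeometry.AbelianSchemes.AbelianSchemeDualPairBaseChange
import Literature.AlgebraicGeometry.AbelianSchemes.AbelianSchemeOverZariskiGluingHom
import HarnessLib

/-!
# The dual transport along a BASE-CHANGE SQUARE: `Ĝ : Â' → Â` over `g : S' → S` for a cartesian chart `G : A' → A`
# of abelian schemes — [MFK94] Cor. 6.8 «`(X ×_S T)^ = X̂ ×_S T`» read through the uniqueness of the dual pair ([Milne AV] I §8)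

Topic `AlgebraicGeometry/AbelianSchemes`; namespace `Literature.AlgebraicGeometry.AbelianSchemes.AbelianSchemeOver`.
Cell hodgecm-mathlib (D-0151), F-DAG hand (h7)(D-F3) FILE A (generic brick; consumer FILE B
`AbelianSchemeOverZariskiGluingPolarizationOfDualPairs` = the `Ĝ/hĜ/poincare` fields of ★ (P1) `PolarizationDatum`, and
B-p06's (10a)/(J2) road (ε) «dual pair downstairs + uniqueness upstairs»).

The tree's ★ `AbelianSchemeDualTransport` builds the dual transport `Ĥ_e : Â' → Â` of an ISOMORPHISM `e : A' ≅ A` of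
abelian schemes over ONE base `S` (with its Poincaré clause, uniqueness ★ `AbelianSchemeDualTransportUnique`, and the
group-scheme clause over a connected locally Noetherian base ★ `AbelianSchemeDualTransportNoetherian`), and ★
`AbelianSchemeDualPairBaseChange` builds the base change `D.baseChange g = (Â ×_S S', 𝒫_{S'})` of a dual pair.  THIS FILE
composes the two for an arbitrary CARTESIAN CHART of abelian schemes, i.e. a base change of group schemes
`G : A' → A` over `g : S' → S` in the sense of ★ `AbelianSchemeOver.IsBaseChangeVia` ([MumfordFogartyKirwan1994, Def. 7.2]'s
pull-back relation), and dual pairs `D = (Â, 𝒫)` of `A`, `D' = (Â', 𝒫')` of `A'`: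

* §1 `IsBaseChangeVia.isoBaseChange h : A'.X ≅ (A.baseChange g).X` — the chart IS the chosen base change, as a GROUP
  scheme (`isMonHom_isoBaseChange_hom/_inv`, ★ `isBaseChangeVia_id_of_comp_eq` both ways);
* §2 **`DualPair.hatTransportOfBaseChange D D' h : Â' ⟶ Â`** `:= Ĥ_{isoBaseChange} ≫ pr₁` (the dual transport to
  `D.baseChange g` followed by `Â ×_S S' → Â`), lying over `g` (`hatTransportOfBaseChange_comp_hom`);
* §3 the POINCARÉ CLAUSE `(G × Ĝ)^*𝒫 ≅ 𝒫'` (`nonempty_pullback_map_hatTransportOfBaseChange_iso`) — verbatim the clause of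
  ★ `PolarizedAbelianSchemeWithLevel.IsBaseChangeVia` — and UNIQUENESS (`eq_hatTransportOfBaseChange_of_nonempty_pullback_map_iso`:
  ANY `Ĝ₁ : Â' → Â` over `g` with that clause is `Ĝ`; [MilneAV2008, I §8] «unique», through ★ K3-a
  `eq_hatTransport_of_nonempty_pullback_map_iso'` for the lift `Â' → Â ×_S S'`);
* §4 `isPullback_hatTransportOfBaseChange` — the square `(Ĝ, g)` is cartesian (hypothesis-free: `Ĥ` is an isomorphism);
  `nonempty_unitHatSlice_baseChange_iso` — the unit hypothesis `𝒫|_{A × {ε_Â}} ≅ 𝒪` passes to `D.baseChange g`; and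
  **`hat_isBaseChangeVia_hatTransportOfBaseChange_of_isLocallyNoetherian`** — over a connected locally Noetherian `S'`,
  under the unit hypotheses, `Ĝ` exhibits `Â'` as the base change of `Â` along `g` AS GROUP SCHEMES
  (★ `hat_isBaseChangeVia_id_hatTransport_of_isLocallyNoetherian` ∘ ★ `baseChange_isBaseChangeVia`) — the `hĜ` field of ★
  `PolarizationDatum`, i.e. [MumfordFogartyKirwan1994, Ch. 6 §1 Cor. 6.8; remark after Def. 7.5 (p. 130)]
  «`ϖ × 1_T : X ×_S T → X̂ ×_S T = (X ×_S T)^`»: formation of the dual commutes with base change;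
* §5 `nonempty_pullback_map_comp_iso` — Poincaré clauses COMPOSE along composable squares (the inline step of ★
  `PolarizedAbelianSchemeWithLevel.IsBaseChangeVia.trans`, stated alone for consumers gluing chart data).

No named fact, no `sorry`, no instance, no notation.  HC_CM is proved only modulo the printed citations until rung 0
closes; this file discharges none of them.

## References
* [MumfordFogartyKirwan1994] D. Mumford, J. Fogarty, F. Kirwan, *Geometric Invariant Theory*, 3rd ed. (1994), Ch. 6 §1
  Cor. 6.8 (p. 118), §2 (p. 121); Ch. 7 §2 Def. 7.2 (p. 129), Def. 7.3 (p. 129), remark after Def. 7.5 (p. 130).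
* [MilneAV2008] J. S. Milne, *Abelian Varieties* (v2.00, 2008), I §8 pp. 36–37 (the dual pair is unique up to a unique
  isomorphism).
* [GortzWedhorn2020] U. Görtz, T. Wedhorn, *Algebraic Geometry I*, 2nd ed. (2020), Section (4.8) Lemma 4.28; Prop. 4.16
  (p. 101); Section (4.15) / Def. 4.42 (p. 116).
-/

universe u

open CategoryTheory CategoryTheory.Limits AlgebraicGeometry MonoidalCategory

noncomputable section

namespace Literature.AlgebraicGeometry.AbelianSchemes

namespace AbelianSchemeOver

open Literature.AlgebraicGeometry.Motives Literature.AlgebraicGeometry.Modules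
open scoped MonObj

variable {S S' : Scheme.{u}} {A : AbelianSchemeOver S} {A' : AbelianSchemeOver S'} {g : S' ⟶ S}
  {G : A'.X.left ⟶ A.X.left}

/-! ### §1 The chart is the chosen base change, as a group scheme -/

namespace IsBaseChangeVia

/-- **The comparison isomorphism `A' ≅ A ×_S S'` of `S'`-schemes** of a base-change square `G : A' → A` over `g`
(Mathlib `IsPullback.isoPullback` of its cartesian square). [cite: GortzWedhorn2020, Section (4.8) Lemma 4.28] -/
def isoBaseChange (h : A'.IsBaseChangeVia A g G) : A'.X ≅ (A.baseChange g).X :=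
  Over.isoMk h.snd.1.isoPullback h.snd.1.isoPullback_hom_snd

/-- Its underlying morphism followed by `pr₁ : A ×_S S' → A` is `G`. [cite: GortzWedhorn2020, Section (4.8) Lemma 4.28] -/
@[reassoc]
theorem isoBaseChange_hom_left_fst (h : A'.IsBaseChangeVia A g G) :
    h.isoBaseChange.hom.left ≫ pullback.fst A.X.hom g = G :=
  h.snd.1.isoPullback_hom_fst

/-- Its underlying morphism lies over `S'`. [cite: GortzWedhorn2020, Section (4.8) Lemma 4.28] -/
@[reassoc]
theorem isoBaseChange_hom_left_snd (h : A'.IsBaseChangeVia A g G) :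
    h.isoBaseChange.hom.left ≫ pullback.snd A.X.hom g = A'.X.hom :=
  h.snd.1.isoPullback_hom_snd

/-- The inverse followed by `G` is `pr₁`. [cite: GortzWedhorn2020, Section (4.8) Lemma 4.28] -/
@[reassoc]
theorem isoBaseChange_inv_left_comp (h : A'.IsBaseChangeVia A g G) :
    h.isoBaseChange.inv.left ≫ G = pullback.fst A.X.hom g :=
  h.snd.1.isoPullback_inv_fst

/-- The inverse lies over `S'`. [cite: GortzWedhorn2020, Section (4.8) Lemma 4.28] -/
@[reassoc]
theorem isoBaseChange_inv_left_comp_hom (h : A'.IsBaseChangeVia A g G) :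
    h.isoBaseChange.inv.left ≫ A'.X.hom = pullback.snd A.X.hom g :=
  h.snd.1.isoPullback_inv_snd

/-- **`isoBaseChange` is an isomorphism of `S'`-GROUP schemes**: `A'` (via `G`) and `A ×_S S'` (★ `baseChange_isBaseChangeVia`)
are both base changes of `A` along `g`, hence related along `𝟙 S'` (★ `isBaseChangeVia_id_of_comp_eq`, FILE 8b ★
`isMonHom_of_isBaseChangeVia_id`). [cite: MumfordFogartyKirwan1994, Ch. 7 §2 Definition 7.2 (p. 129)]
[cite: GortzWedhorn2020, Section (4.15) (p. 116) and Definition 4.42 (p. 116)] -/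
theorem isMonHom_isoBaseChange_hom (h : A'.IsBaseChangeVia A g G) : IsMonHom h.isoBaseChange.hom :=
  isMonHom_of_isBaseChangeVia_id _ (isBaseChangeVia_id_of_comp_eq (A.baseChange_isBaseChangeVia g) h
    h.isoBaseChange.hom.left h.isoBaseChange_hom_left_fst h.isoBaseChange_hom_left_snd)

/-- The inverse `A ×_S S' ≅ A'` is a homomorphism too (same argument with the roles exchanged).
[cite: MumfordFogartyKirwan1994, Ch. 7 §2 Definition 7.2 (p. 129)] [cite: GortzWedhorn2020, Prop. 4.16 (p. 101)] -/
theorem isMonHom_isoBaseChange_inv (h : A'.IsBaseChangeVia A g G) : IsMonHom h.isoBaseChange.inv :=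
  isMonHom_of_isBaseChangeVia_id _ (isBaseChangeVia_id_of_comp_eq h (A.baseChange_isBaseChangeVia g)
    h.isoBaseChange.inv.left h.isoBaseChange_inv_left_comp h.isoBaseChange_inv_left_comp_hom)

/-- `isoBaseChange.symm.hom` is a homomorphism (the form ★ `isIso_hatTransport` consumes).
[cite: GortzWedhorn2020, Prop. 4.16 (p. 101)] -/
theorem isMonHom_isoBaseChange_symm_hom (h : A'.IsBaseChangeVia A g G) : IsMonHom h.isoBaseChange.symm.hom :=
  h.isMonHom_isoBaseChange_inv

end IsBaseChangeVia

/-! ### §2 The dual transport along the square -/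

namespace DualPair

variable (D : A.DualPair) (D' : A'.DualPair) (h : A'.IsBaseChangeVia A g G)

/-- The dual transport `Ĥ : Â' → Â ×_S S'` to the base-changed dual pair `D.baseChange g` along the group-scheme
isomorphism `isoBaseChange h : A' ≅ A ×_S S'` (★ `hatTransport`; non-Prop plumbing). [cite: MilneAV2008, I §8 pp. 36–37]
[cite: MumfordFogartyKirwan1994, Ch. 6 §1 Cor. 6.8 (p. 118)] -/
def hatLift : D'.hat.X.left ⟶ (D.baseChange g).hat.X.left :=
  haveI := h.isMonHom_isoBaseChange_hom
  hatTransport (D.baseChange g) D' h.isoBaseChange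

/-- `Ĥ` lies over `S'`. [cite: MilneAV2008, I §8 pp. 36–37] -/
@[reassoc]
theorem hatLift_comp_snd : hatLift D D' h ≫ pullback.snd D.hat.X.hom g = D'.hat.X.hom := by
  haveI := h.isMonHom_isoBaseChange_hom
  exact hatTransport_comp_hom (D.baseChange g) D' h.isoBaseChange

/-- **THE DUAL TRANSPORT ALONG A BASE-CHANGE SQUARE** `Ĝ : Â' → Â` over `g : S' → S`: the dual transport to
`Â ×_S S'` followed by the projection — [MumfordFogartyKirwan1994] remark after Def. 7.5: «`X̂ ×_S T = (X ×_S T)^`».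
[cite: MumfordFogartyKirwan1994, Ch. 7 §2 remark after Definition 7.5 (p. 130)] [cite: MilneAV2008, I §8 pp. 36–37] -/
def hatTransportOfBaseChange : D'.hat.X.left ⟶ D.hat.X.left :=
  hatLift D D' h ≫ pullback.fst D.hat.X.hom g

/-- `Ĝ = Ĥ ≫ pr₁` (definitional). [cite: MilneAV2008, I §8 pp. 36–37] -/
theorem hatTransportOfBaseChange_eq : hatTransportOfBaseChange D D' h = hatLift D D' h ≫ pullback.fst D.hat.X.hom g :=
  rfl

/-- **`Ĝ` lies over `g`**: `Ĝ ≫ π̂ = π̂' ≫ g`. [cite: MumfordFogartyKirwan1994, Ch. 7 §2 Definition 7.2 (p. 129)] -/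
@[reassoc]
theorem hatTransportOfBaseChange_comp_hom :
    hatTransportOfBaseChange D D' h ≫ D.hat.X.hom = D'.hat.X.hom ≫ g :=
  (Category.assoc _ _ _).trans
    ((congrArg (hatLift D D' h ≫ ·) (pullback.condition (f := D.hat.X.hom) (g := g))).trans
      ((Category.assoc _ _ _).symm.trans (congrArg (· ≫ g) (hatLift_comp_snd D D' h))))

/-- `hatTransportOfBaseChange` depends on the square `(g, G)` only through its underlying maps (transport along equalities
of the base map and of the chart map). [cite: MumfordFogartyKirwan1994, Ch. 7 §2 Definition 7.2 (p. 129)] -/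
theorem hatTransportOfBaseChange_congr {g' : S' ⟶ S} {G' : A'.X.left ⟶ A.X.left} (eg : g = g') (eG : G = G')
    (h' : A'.IsBaseChangeVia A g' G') :
    hatTransportOfBaseChange D D' h = hatTransportOfBaseChange D D' h' := by
  subst eg eG
  rfl

/-! ### §3 The Poincaré clause `(G × Ĝ)^*𝒫 ≅ 𝒫'` and uniqueness -/

/-- The comparison square into `A ×_S Â`: for any `S'`-morphism `Ĥ : Â' → Â ×_S S'`,
`(isoBaseChange × Ĥ) ≫ (pr × pr) = G × (Ĥ ≫ pr₁)`. [cite: MumfordFogartyKirwan1994, Ch. 7 §2 Definition 7.2 (p. 129)] -/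
theorem pullback_map_comp_prodBaseChangeToProd (Ĥ : D'.hat.X.left ⟶ (D.baseChange g).hat.X.left)
    (hĤ : Ĥ ≫ pullback.snd D.hat.X.hom g = D'.hat.X.hom)
    (wG : A'.X.hom ≫ g = G ≫ A.X.hom) (wĜ : D'.hat.X.hom ≫ g = (Ĥ ≫ pullback.fst D.hat.X.hom g) ≫ D.hat.X.hom) :
    pullback.map A'.X.hom D'.hat.X.hom (A.baseChange g).X.hom (D.baseChange g).hat.X.hom h.isoBaseChange.hom.left Ĥ
        (𝟙 S') (by rw [Category.comp_id, Over.w]) (by rw [Category.comp_id]; exact hĤ.symm) ≫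
        D.prodBaseChangeToProd g =
      pullback.map A'.X.hom D'.hat.X.hom A.X.hom D.hat.X.hom G (Ĥ ≫ pullback.fst D.hat.X.hom g) g wG wĜ := by
  have e1 : D.prodBaseChangeToProd g ≫ pullback.fst A.X.hom D.hat.X.hom =
      pullback.fst (A.baseChange g).X.hom (D.baseChange g).hat.X.hom ≫ pullback.fst A.X.hom g :=
    D.prodBaseChangeToProd_fst g
  have e1' : D.prodBaseChangeToProd g ≫ pullback.snd A.X.hom D.hat.X.hom =
      pullback.snd (A.baseChange g).X.hom (D.baseChange g).hat.X.hom ≫ pullback.fst D.hat.X.hom g :=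
    D.prodBaseChangeToProd_snd g
  apply pullback.hom_ext
  · exact (Category.assoc _ _ _).trans
      ((congrArg (_ ≫ ·) e1).trans
        ((Category.assoc _ _ _).symm.trans
          ((congrArg (· ≫ pullback.fst A.X.hom g) (pullback.lift_fst _ _ _)).trans
            ((Category.assoc _ _ _).trans
              ((congrArg (pullback.fst A'.X.hom D'.hat.X.hom ≫ ·) h.isoBaseChange_hom_left_fst).trans
                (pullback.lift_fst _ _ _).symm)))))
  · exact (Category.assoc _ _ _).trans
      ((congrArg (_ ≫ ·) e1').trans
        ((Category.assoc _ _ _).symm.trans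
          ((congrArg (· ≫ pullback.fst D.hat.X.hom g) (pullback.lift_snd _ _ _)).trans
            ((Category.assoc _ _ _).trans (pullback.lift_snd _ _ _).symm))))

/-- **THE POINCARÉ CLAUSE** `(G × Ĝ)^*𝒫 ≅ 𝒫'` of [MumfordFogartyKirwan1994] Def. 7.2/7.3 for the square `(G, Ĝ)` over `g`
(★ `nonempty_pullback_map_hatTransport_iso` for `Ĥ`, whose target Poincaré module is `(pr × pr)^*𝒫` = ★ `PBaseChange`).
[cite: MumfordFogartyKirwan1994, Ch. 7 §2 Definition 7.3 (p. 129)] [cite: MilneAV2008, I §8 pp. 36–37] -/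
theorem nonempty_pullback_map_hatTransportOfBaseChange_iso
    (wG : A'.X.hom ≫ g = G ≫ A.X.hom) (wĜ : D'.hat.X.hom ≫ g = hatTransportOfBaseChange D D' h ≫ D.hat.X.hom) :
    Nonempty ((Scheme.Modules.pullback
      (pullback.map A'.X.hom D'.hat.X.hom A.X.hom D.hat.X.hom G (hatTransportOfBaseChange D D' h) g wG wĜ)).obj D.P ≅
        D'.P) := by
  haveI := h.isMonHom_isoBaseChange_hom
  obtain ⟨i⟩ := nonempty_pullback_map_hatTransport_iso (D.baseChange g) D' h.isoBaseChange
  have sq := pullback_map_comp_prodBaseChangeToProd D D' h (hatLift D D' h) (hatLift_comp_snd D D' h) wG wĜ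
  exact ⟨(Scheme.Modules.pullbackCongr sq.symm).app D.P ≪≫ ((Scheme.Modules.pullbackComp _ _).app D.P).symm ≪≫ i⟩

/-- **UNIQUENESS OF THE DUAL TRANSPORT ALONG A SQUARE**: an `Ĝ₁ : Â' → Â` over `g` carrying the Poincaré clause
`(G × Ĝ₁)^*𝒫 ≅ 𝒫'` IS `hatTransportOfBaseChange D D' h` — its lift `Â' → Â ×_S S'` carries the clause for the base-changed
pair, hence is the dual transport `Ĥ` by ★ K3-a (`eq_hatTransport_of_nonempty_pullback_map_iso'`; [MilneAV2008, I §8]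
«unique»). [cite: MilneAV2008, I §8 pp. 36–37] [cite: MumfordFogartyKirwan1994, Ch. 7 §2 Definition 7.3 (p. 129)] -/
theorem eq_hatTransportOfBaseChange_of_nonempty_pullback_map_iso (Ĝ₁ : D'.hat.X.left ⟶ D.hat.X.left)
    (hĜ₁ : Ĝ₁ ≫ D.hat.X.hom = D'.hat.X.hom ≫ g) (wG : A'.X.hom ≫ g = G ≫ A.X.hom)
    (hP : Nonempty ((Scheme.Modules.pullback
      (pullback.map A'.X.hom D'.hat.X.hom A.X.hom D.hat.X.hom G Ĝ₁ g wG hĜ₁.symm)).obj D.P ≅ D'.P)) :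
    Ĝ₁ = hatTransportOfBaseChange D D' h := by
  haveI := h.isMonHom_isoBaseChange_hom
  -- the lift `Ĥ₁ : Â' → Â ×_S S'` of `Ĝ₁`
  let Ĥ₁ : D'.hat.X.left ⟶ (D.baseChange g).hat.X.left := pullback.lift Ĝ₁ D'.hat.X.hom hĜ₁
  have hĤ₁ : Ĥ₁ ≫ pullback.snd D.hat.X.hom g = D'.hat.X.hom := pullback.lift_snd _ _ _
  have hĤ₁' : Ĥ₁ ≫ pullback.fst D.hat.X.hom g = Ĝ₁ := pullback.lift_fst _ _ _
  have wĜ' : D'.hat.X.hom ≫ g = (Ĥ₁ ≫ pullback.fst D.hat.X.hom g) ≫ D.hat.X.hom := by rw [hĤ₁']; exact hĜ₁.symm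
  have sq := pullback_map_comp_prodBaseChangeToProd D D' h Ĥ₁ hĤ₁ wG wĜ'
  -- the Poincaré clause for `Ĥ₁` and the base-changed pair
  have hmaps : pullback.map A'.X.hom D'.hat.X.hom A.X.hom D.hat.X.hom G (Ĥ₁ ≫ pullback.fst D.hat.X.hom g) g wG wĜ' =
      pullback.map A'.X.hom D'.hat.X.hom A.X.hom D.hat.X.hom G Ĝ₁ g wG hĜ₁.symm := by
    apply pullback.hom_ext
    · rw [pullback.lift_fst, pullback.lift_fst]
    · rw [pullback.lift_snd, pullback.lift_snd, hĤ₁']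
  obtain ⟨i⟩ := hP
  have hP' : Nonempty ((Scheme.Modules.pullback
      (pullback.map A'.X.hom D'.hat.X.hom (A.baseChange g).X.hom (D.baseChange g).hat.X.hom h.isoBaseChange.hom.left Ĥ₁
        (𝟙 S') (by rw [Category.comp_id, Over.w]) (by rw [Category.comp_id]; exact hĤ₁.symm))).obj
          (D.baseChange g).P ≅ D'.P) :=
    ⟨(Scheme.Modules.pullbackComp _ _).app D.P ≪≫ (Scheme.Modules.pullbackCongr (sq.trans hmaps)).app D.P ≪≫ i⟩
  have key : Ĥ₁ = hatLift D D' h :=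
    eq_hatTransport_of_nonempty_pullback_map_iso' (D.baseChange g) D' h.isoBaseChange Ĥ₁ hĤ₁ hP'
  rw [← hĤ₁', key]
  rfl

/-! ### §4 The square `(Ĝ, g)` is cartesian; the group-scheme clause over a connected locally Noetherian base -/

/-- `Ĥ : Â' → Â ×_S S'` is an isomorphism (★ `isIso_hatTransport` with the inverse group-scheme isomorphism
`isoBaseChange.symm`). [cite: MilneAV2008, I §8 pp. 36–37] -/
theorem isIso_hatLift : IsIso (hatLift D D' h) := by
  haveI := h.isMonHom_isoBaseChange_hom
  haveI := h.isMonHom_isoBaseChange_symm_hom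
  exact isIso_hatTransport (D.baseChange g) D' h.isoBaseChange h.isoBaseChange.symm rfl

/-- **The square `(Ĝ, g)` is CARTESIAN**: `Â' ≅ Â ×_S S'` via `Ĥ` (no hypothesis on the base).
[cite: MumfordFogartyKirwan1994, Ch. 7 §2 remark after Definition 7.5 (p. 130)] [cite: GortzWedhorn2020, Section (4.8) Lemma 4.28] -/
theorem isPullback_hatTransportOfBaseChange :
    IsPullback (hatTransportOfBaseChange D D' h) D'.hat.X.hom D.hat.X.hom g := by
  haveI := isIso_hatLift D D' h
  have sq₁ : IsPullback (hatLift D D' h) D'.hat.X.hom (pullback.snd D.hat.X.hom g) (𝟙 S') :=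
    IsPullback.of_horiz_isIso ⟨by rw [Category.comp_id, hatLift_comp_snd]⟩
  have sq := sq₁.paste_horiz (IsPullback.of_hasPullback D.hat.X.hom g)
  rwa [Category.id_comp] at sq

/-- The unit-HAT-slice square for the base change: `(A_{S'} × {ε_{Â_{S'}}}) ≫ (pr × pr) = pr_A ≫ (A × {ε_Â})`.
[cite: MumfordFogartyKirwan1994, Ch. 6 §2 (p. 121)] -/
@[reassoc]
theorem unitHatSlice_baseChange_comp_prodBaseChangeToProd :
    unitHatSlice (D.baseChange g) ≫ D.prodBaseChangeToProd g = pullback.fst A.X.hom g ≫ unitHatSlice D := by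
  have e1 : D.prodBaseChangeToProd g ≫ pullback.fst A.X.hom D.hat.X.hom =
      pullback.fst (A.baseChange g).X.hom (D.baseChange g).hat.X.hom ≫ pullback.fst A.X.hom g :=
    D.prodBaseChangeToProd_fst g
  have e1' : D.prodBaseChangeToProd g ≫ pullback.snd A.X.hom D.hat.X.hom =
      pullback.snd (A.baseChange g).X.hom (D.baseChange g).hat.X.hom ≫ pullback.fst D.hat.X.hom g :=
    D.prodBaseChangeToProd_snd g
  have u1 : unitHatSlice (D.baseChange g) ≫ pullback.fst (A.baseChange g).X.hom (D.baseChange g).hat.X.hom = 𝟙 _ :=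
    unitHatSlice_fst (D.baseChange g)
  have u2 : unitHatSlice (D.baseChange g) ≫ pullback.snd (A.baseChange g).X.hom (D.baseChange g).hat.X.hom =
      (A.baseChange g).X.hom ≫ (D.baseChange g).hat.unitSection :=
    unitHatSlice_snd (D.baseChange g)
  have u3 : (D.baseChange g).hat.unitSection ≫ pullback.fst D.hat.X.hom g = g ≫ D.hat.unitSection :=
    unitSection_baseChange_comp_fst D.hat g
  have hA : (A.baseChange g).X.hom ≫ g = pullback.fst A.X.hom g ≫ A.X.hom :=
    (pullback.condition (f := A.X.hom) (g := g)).symm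
  apply pullback.hom_ext
  · exact (Category.assoc _ _ _).trans
      ((congrArg (_ ≫ ·) e1).trans
        ((Category.assoc _ _ _).symm.trans
          ((congrArg (· ≫ pullback.fst A.X.hom g) u1).trans
            ((Category.id_comp _).trans
              ((Category.comp_id _).symm.trans
                ((congrArg (pullback.fst A.X.hom g ≫ ·) (unitHatSlice_fst D)).symm.trans
                  (Category.assoc _ _ _).symm))))))
  · exact (Category.assoc _ _ _).trans
      ((congrArg (_ ≫ ·) e1').trans
        ((Category.assoc _ _ _).symm.trans
          ((congrArg (· ≫ pullback.fst D.hat.X.hom g) u2).trans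
            ((Category.assoc _ _ _).trans
              ((congrArg ((A.baseChange g).X.hom ≫ ·) u3).trans
                ((Category.assoc _ _ _).symm.trans
                  ((congrArg (· ≫ D.hat.unitSection) hA).trans
                    ((Category.assoc _ _ _).trans
                      ((congrArg (pullback.fst A.X.hom g ≫ ·) (unitHatSlice_snd D)).symm.trans
                        (Category.assoc _ _ _).symm)))))))))

/-- **The unit hypothesis `𝒫|_{A × {ε_Â}} ≅ 𝒪` passes to the base change** `D.baseChange g`:
`𝒫_{S'}|_{A_{S'} × {ε}} = pr^*(𝒫|_{A × {ε_Â}}) ≅ pr^*𝒪 ≅ 𝒪` (pattern of ★ `rigid_PBaseChange`).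
[cite: MumfordFogartyKirwan1994, Ch. 6 §2 (p. 121)] [cite: MilneAV2008, I §8 pp. 36–37] -/
theorem nonempty_unitHatSlice_baseChange_iso
    (hD : Nonempty ((Scheme.Modules.pullback (unitHatSlice D)).obj D.P ≅ SheafOfModules.unit _)) :
    Nonempty ((Scheme.Modules.pullback (unitHatSlice (D.baseChange g))).obj (D.baseChange g).P ≅
      SheafOfModules.unit _) := by
  obtain ⟨r⟩ := hD
  refine ⟨(Scheme.Modules.pullbackComp _ _).app D.P ≪≫
    (Scheme.Modules.pullbackCongr (unitHatSlice_baseChange_comp_prodBaseChangeToProd D (g := g))).app D.P ≪≫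
    ((Scheme.Modules.pullbackComp _ _).app D.P).symm ≪≫
    (Scheme.Modules.pullback (pullback.fst A.X.hom g)).mapIso r ≪≫ ?_⟩
  have hI : IsIso (SheafOfModules.pullbackObjUnitToUnit (pullback.fst A.X.hom g).toRingCatSheafHom) := by
    haveI := Literature.AlgebraicGeometry.KTheory.final_opensMap (pullback.fst A.X.hom g)
    exact SheafOfModules.instIsIsoPullbackObjUnitToUnitOfFinal _
  exact @asIso _ _ _ _ (SheafOfModules.pullbackObjUnitToUnit (pullback.fst A.X.hom g).toRingCatSheafHom) hI

/-- **THE GROUP-SCHEME CLAUSE: `Ĝ` exhibits `Â'` as the base change of `Â` along `g` AS GROUP SCHEMES** over a connected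
locally Noetherian `S'`, under the unit hypotheses `𝒫|_{A × {ε_Â}} ≅ 𝒪`, `𝒫'|_{A' × {ε_{Â'}}} ≅ 𝒪` (automatic for polarised
abelian schemes fibrewise, ★ `AbelianSchemeDualTransportUnit`): `Ĥ` is a base change along `𝟙 S'` as group schemes (★
p759971 `hat_isBaseChangeVia_id_hatTransport_of_isLocallyNoetherian`, [MumfordFogartyKirwan1994] Cor. 6.4 in Stein form) and
`pr₁ : Â ×_S S' → Â` one along `g` (★ `baseChange_isBaseChangeVia`); squares compose (★ `IsBaseChangeVia.trans`).  This is
the `hĜ` field of ★ (P1) `PolarizationDatum` and [MumfordFogartyKirwan1994] Cor. 6.8's «`(X ×_S T)^ = X̂ ×_S T`».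
[cite: MumfordFogartyKirwan1994, Ch. 6 §1 Cor. 6.8 (p. 118) and Ch. 7 §2 remark after Definition 7.5 (p. 130)]
[cite: MilneAV2008, I §8 pp. 36–37] -/
theorem hat_isBaseChangeVia_hatTransportOfBaseChange_of_isLocallyNoetherian [IsLocallyNoetherian S']
    [PreconnectedSpace S']
    (hD : Nonempty ((Scheme.Modules.pullback (unitHatSlice D)).obj D.P ≅ SheafOfModules.unit _))
    (hD' : Nonempty ((Scheme.Modules.pullback (unitHatSlice D')).obj D'.P ≅ SheafOfModules.unit _)) :
    D'.hat.IsBaseChangeVia D.hat g (hatTransportOfBaseChange D D' h) := by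
  haveI := h.isMonHom_isoBaseChange_hom
  haveI := h.isMonHom_isoBaseChange_symm_hom
  have h₁ : D'.hat.IsBaseChangeVia (D.baseChange g).hat (𝟙 S') (hatLift D D' h) :=
    hat_isBaseChangeVia_id_hatTransport_of_isLocallyNoetherian (D.baseChange g) D' h.isoBaseChange
      h.isoBaseChange.symm rfl (nonempty_unitHatSlice_baseChange_iso D hD) hD'
  have h₂ : D'.hat.IsBaseChangeVia D.hat (𝟙 S' ≫ g) (hatTransportOfBaseChange D D' h) :=
    h₁.trans (D.hat.baseChange_isBaseChangeVia g)
  exact (congrArg (fun x => D'.hat.IsBaseChangeVia D.hat x (hatTransportOfBaseChange D D' h))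
    (Category.id_comp g)).mp h₂

/-! ### §5 Poincaré clauses compose -/

omit A A' in
/-- **Poincaré clauses COMPOSE**: if `(G', Ĝ')` over `g'` carries `𝒫'` to `𝒫''` and `(G, Ĝ)` over `g` carries `𝒫` to `𝒫'`,
then `(G' ≫ G, Ĝ' ≫ Ĝ)` over `g' ≫ g` carries `𝒫` to `𝒫''` (Mathlib `pullback.map_comp`; the inline Poincaré step of ★
`PolarizedAbelianSchemeWithLevel.IsBaseChangeVia.trans`). [cite: MumfordFogartyKirwan1994, Ch. 7 §2 Definition 7.2 (p. 129)] -/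
theorem nonempty_pullback_map_comp_iso {S S' S'' : Scheme.{u}} {B : AbelianSchemeOver S} {B' : AbelianSchemeOver S'}
    {B'' : AbelianSchemeOver S''} (E : B.DualPair) (E' : B'.DualPair) (E'' : B''.DualPair) {g : S' ⟶ S}
    {g' : S'' ⟶ S'} {G : B'.X.left ⟶ B.X.left} {Ĝ : E'.hat.X.left ⟶ E.hat.X.left} {G' : B''.X.left ⟶ B'.X.left}
    {Ĝ' : E''.hat.X.left ⟶ E'.hat.X.left} (wG : B'.X.hom ≫ g = G ≫ B.X.hom)
    (wĜ : E'.hat.X.hom ≫ g = Ĝ ≫ E.hat.X.hom) (wG' : B''.X.hom ≫ g' = G' ≫ B'.X.hom)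
    (wĜ' : E''.hat.X.hom ≫ g' = Ĝ' ≫ E'.hat.X.hom)
    (hP : Nonempty ((Scheme.Modules.pullback
      (pullback.map B'.X.hom E'.hat.X.hom B.X.hom E.hat.X.hom G Ĝ g wG wĜ)).obj E.P ≅ E'.P))
    (hP' : Nonempty ((Scheme.Modules.pullback
      (pullback.map B''.X.hom E''.hat.X.hom B'.X.hom E'.hat.X.hom G' Ĝ' g' wG' wĜ')).obj E'.P ≅ E''.P))
    (wG'' : B''.X.hom ≫ g' ≫ g = (G' ≫ G) ≫ B.X.hom) (wĜ'' : E''.hat.X.hom ≫ g' ≫ g = (Ĝ' ≫ Ĝ) ≫ E.hat.X.hom) :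
    Nonempty ((Scheme.Modules.pullback
      (pullback.map B''.X.hom E''.hat.X.hom B.X.hom E.hat.X.hom (G' ≫ G) (Ĝ' ≫ Ĝ) (g' ≫ g) wG'' wĜ'')).obj E.P ≅
        E''.P) := by
  obtain ⟨e⟩ := hP
  obtain ⟨e'⟩ := hP'
  have hcomp : pullback.map B''.X.hom E''.hat.X.hom B.X.hom E.hat.X.hom (G' ≫ G) (Ĝ' ≫ Ĝ) (g' ≫ g) wG'' wĜ'' =
      pullback.map B''.X.hom E''.hat.X.hom B'.X.hom E'.hat.X.hom G' Ĝ' g' wG' wĜ' ≫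
        pullback.map B'.X.hom E'.hat.X.hom B.X.hom E.hat.X.hom G Ĝ g wG wĜ :=
    (pullback.map_comp G' G Ĝ' Ĝ g' g wG' wĜ' wG wĜ).symm
  exact ⟨(Scheme.Modules.pullbackCongr hcomp).app E.P ≪≫ ((Scheme.Modules.pullbackComp _ _).app E.P).symm ≪≫
    (Scheme.Modules.pullback _).mapIso e ≪≫ e'⟩

end DualPair

end AbelianSchemeOver

end Literature.AlgebraicGeometry.AbelianSchemes

end
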